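import Literature.Probability.RandomPlanarGeometry.SLETraceApproximation
import Literature.Probability.Process.PathSpaceTightness
import Literature.Probability.Process.PathSpaceModulus
import Literature.Probability.Process.PathSpaceCoupling
import Literature.Probability.Process.KolmogorovExtensionProofs
import Literature.Probability.Process.BrownianMotionProofs
import HarnessLib

/-!
# SLE₈ is generated by a curve: the proof of [LSW04] Thm. 4.7 assembled down to its two probabilistic inputs

Tenure file of the named fact `Literature.Probability.RandomPlanarGeometry.hasSLETrace_eight`
(Lawler–Schramm–Werner, *Conformal invariance of planar loop-erased random walks and uniform
spanning trees*, Ann. Probab. 32 (2004), Thm. 4.7). The printed proof (p. 981) combines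

* (P) two statements about the uniform spanning tree Peano curves `γ̂ = γ̂_R` of the grid
  approximations `D^R` (§4.3) — **Prop. 4.5** (uniform continuity estimate: for `ε, t > 0` there
  are `R₀, δ > 0` with `P[sup{|γ̂(t₂) - γ̂(t₁)| : t₁, t₂ ≤ t, |t₂ - t₁| ≤ δ} ≥ ε] < ε` for
  `R > R₀`) and **Thm. 4.4** (driving process convergence: for all large `R` a coupling of the
  driving process `W` of `γ̂` with a standard Brownian motion `B` with
  `P[sup_{[0, T]} |W(t) - B(8t)| > ε₂] < ε₃`) — with
* (D) deterministic / measure-theoretic steps: Arzelà–Ascoli tightness, Prokhorov, the chordal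
  Lemma 3.14, portmanteau, identification of the limit.

All of (D) is now PROVED in the tree (`SLETraceEight`, `SLETraceEightKernel`,
`SLETraceApproximation`, `Process.PathSpaceBorel/Tightness/Modulus/Coupling`). This file composes
them into ONE theorem whose hypotheses have exactly the printed shapes of Prop. 4.5 and Thm. 4.4
along a sequence `Rₙ → ∞` (`Literature.Probability.RandomPlanarGeometry.hasSLETrace_of_inputs`,
any `κ ≠ 0`; `hasSLETrace_eight_of_inputs` for `κ = 8`): given random continuous curves `Γₙ`
from `0` with a.s. generated Loewner chains of driving functions `Ξₙ` (for the UST Peano curve: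
`Γₙ = φ_{Rₙ} ∘ γ` parametrised by capacity, `Ξₙ` its driving process), the Prop. 4.5-bound for
the `Γₙ` and Thm. 4.4-couplings of the `Ξₙ` with `B(κt)` imply `HasSLETrace κ`. What remains of
`hasSLETrace_eight` is therefore precisely (P) for the UST Peano curve (an XL theory: §4.1 Peano
curve and Lemma 4.1, Prop. 4.2 (§5.4), Prop. 4.3, Thm. 4.4, Lemma 4.6/Prop. 4.5 with Schramm
(2000)), plus the deterministic facts that a simple polygonal curve parametrised by capacity has
a continuous driving function generating its chain.

Also here: the law on path space of the time-changed Brownian motion `t ↦ B(κt)` of ANY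
continuous Brownian motion is the law of the canonical SLE_κ driving path `√κ B`
(`map_timeScaledPath_eq_map_drivingPath`, Brownian scaling + `map_eq_map_drivingPath`), which
converts a coupling "with `B(8t)` for a standard Brownian motion `B`" as printed in Thm. 4.4 into
the canonical form; and the canonical-space facts are used in their PROVED form
(`Process.exists_isProjectiveLimit_holds`, `IsPreBrownianReal.exists_modification_isBrownianReal_holds`),
so no junk branch and no `Fact` hypothesis remains.

## References

* G. F. Lawler, O. Schramm, W. Werner, Ann. Probab. 32 (2004) 939–995: §4.1, Thm. 4.4 (p. 976),
  §4.3, Prop. 4.5 (p. 977), Thm. 4.7 and its proof (pp. 980–981).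
* P. Billingsley, *Convergence of Probability Measures* (2nd ed. 1999), Thms. 3.1, 5.1, 7.3.
-/

noncomputable section

open Set Filter Topology Metric MeasureTheory ProbabilityTheory
open scoped NNReal ENNReal

namespace Literature.Probability.RandomPlanarGeometry

open scoped PathBorel

/-! ### The canonical-space facts, proved -/

/-- The pre-Wiener measure is the Kolmogorov extension of the Brownian finite-dimensional laws
(proved: `Process.exists_isProjectiveLimit_holds`). Kallenberg (2002), Thm. 6.16. [folklore] -/
theorem isProjectiveLimit_preWienerMeasure_holds' : Process.isProjectiveLimit_preWienerMeasure :=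
  Process.isProjectiveLimit_preWienerMeasure_of Process.exists_isProjectiveLimit_holds

/-- The canonical Brownian motion exists (proved: Kolmogorov extension + Kolmogorov–Chentsov,
`IsPreBrownianReal.exists_modification_isBrownianReal_holds`). Kallenberg (2002), Thm. 13.5.
[folklore] -/
theorem exists_isBrownianReal_measurable_continuous_holds' :
    Process.exists_isBrownianReal_measurable_continuous :=
  Process.exists_isBrownianReal_measurable_continuous_of isProjectiveLimit_preWienerMeasure_holds'
    IsPreBrownianReal.exists_modification_isBrownianReal_holds

/-! ### Time-changed Brownian motion `B(κt)` has the law of the SLE_κ driving path -/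

/-- **The law on path space of `t ↦ B(κt)` is the law of `√κ B`**, for any Brownian motion `B`
with continuous paths and measurable marginals on any probability space and `κ ≠ 0`: by
Brownian scaling `B̃(t) = (√κ)⁻¹ B(κt)` is a Brownian motion (Mathlib `IsBrownianReal.smul`) with
continuous paths, `B(κt) = √κ B̃(t)`, and `map_eq_map_drivingPath` identifies the law of `√κ B̃`
with that of the canonical driving path. This converts [LSW04] Thm. 4.4 ("`B(8t)`, where `B(t)`
is standard Brownian motion") to the canonical form. Rohde–Schramm (2005), §2 (scaling).
[cite: LawlerSchrammWerner2004, Thm. 4.4] -/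
theorem map_timeScaledPath_eq_map_drivingPath {κ : ℝ≥0} (hκ : κ ≠ 0)
    {Ω' : Type*} [MeasurableSpace Ω'] {Q : Measure Ω'} {B : ℝ≥0 → Ω' → ℝ}
    (hBM : IsBrownianReal B Q) (hc : ∀ ω, Continuous (B · ω)) (hm : ∀ t, Measurable (B t)) :
    Q.map (fun ω ↦ (⟨fun t ↦ B (κ * t) ω, (hc ω).comp (continuous_const.mul continuous_id)⟩ :
      C(ℝ≥0, ℝ))) = Process.preWienerMeasure.map (drivingPath κ) := by
  -- the rescaled Brownian motion
  set B' : ℝ≥0 → Ω' → ℝ := fun t ω ↦ (Real.sqrt κ)⁻¹ * B (κ * t) ω with hB'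
  have hB'M : IsBrownianReal B' Q := hBM.smul hκ
  have hc' : ∀ ω, Continuous (B' · ω) := fun ω ↦
    continuous_const.mul ((hc ω).comp (continuous_const.mul continuous_id))
  have hm' : ∀ t, Measurable (B' t) := fun t ↦ (hm _).const_mul _
  have hsq : Real.sqrt κ ≠ 0 := Real.sqrt_ne_zero'.2 (by exact_mod_cast pos_iff_ne_zero.2 hκ)
  have heq : (fun ω ↦ (⟨fun t ↦ B (κ * t) ω, (hc ω).comp (continuous_const.mul continuous_id)⟩ :
      C(ℝ≥0, ℝ))) = fun ω ↦ ⟨fun t ↦ Real.sqrt κ * B' t ω, continuous_const.mul (hc' ω)⟩ := by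
    funext ω
    ext t
    simp only [ContinuousMap.coe_mk, hB']
    rw [← mul_assoc, mul_inv_cancel₀ hsq, one_mul]
  rw [heq]
  exact map_eq_map_drivingPath κ exists_isBrownianReal_measurable_continuous_holds' hB'M hc' hm'

/-! ### The assembled reduction: Prop. 4.5-shaped and Thm. 4.4-shaped inputs ⇒ `HasSLETrace κ` -/

section Inputs

variable {κ : ℝ≥0} {Ω : ℕ → Type*} [∀ n, MeasurableSpace (Ω n)] {P : ∀ n, Measure (Ω n)}
  [∀ n, IsProbabilityMeasure (P n)] {Γ : ∀ n, Ω n → C(ℝ≥0, ℂ)} {Ξ : ∀ n, Ω n → C(ℝ≥0, ℝ)}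

/-- **Tightness of the curve laws from a Prop. 4.5-shaped bound.** If the random curves `Γₙ` start
at `0` and for every `t, ε > 0` there is `δ > 0` with, eventually in `n`,
`Pₙ[∃ s, s' ≤ t, |s - s'| ≤ δ, ε ≤ |Γₙ(s) - Γₙ(s')|] < ε` (the shape of [LSW04] Prop. 4.5 along
`Rₙ → ∞`), then the laws of the `Γₙ` are tight on `C([0, ∞), ℂ)`: the bound is upgraded to all
`n` (`Process.forall_measure_modulus_le_of_eventually`) and fed to the Arzelà–Ascoli criterion
(`Process.isTightMeasureSet_range_map_of_modulus`). [LSW04] p. 981 ("tight, because of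
Proposition 4.5 and the Arzelà–Ascoli theorem"). [cite: LawlerSchrammWerner2004, proof of Thm. 4.7] -/
theorem isTightMeasureSet_of_prop45_shape (hΓ : ∀ n, AEMeasurable (Γ n) (P n))
    (h0 : ∀ n ω, Γ n ω 0 = 0)
    (h45 : ∀ (t ε : ℝ), 0 < ε → ∃ δ : ℝ, 0 < δ ∧ ∀ᶠ n in atTop,
      P n {ω | ∃ s s' : ℝ≥0, (s : ℝ) ≤ t ∧ (s' : ℝ) ≤ t ∧ dist s s' ≤ δ ∧
        ε ≤ dist (Γ n ω s) (Γ n ω s')} < ENNReal.ofReal ε) :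
    IsTightMeasureSet (Set.range fun n ↦ (P n).map (Γ n)) := by
  refine Process.isTightMeasureSet_range_map_of_modulus (fun η hη ↦ ⟨{0}, isCompact_singleton,
    fun n ↦ ?_⟩) (Process.forall_measure_modulus_le_of_eventually hΓ fun T ε hε η hη ↦ ?_)
  · have : {ω : Ω n | Γ n ω 0 ∉ ({0} : Set ℂ)} = ∅ := by
      ext ω
      simp [h0 n ω]
    rw [this, measure_empty]
    exact bot_le
  · -- two-parameter version from the printed one-parameter bound
    rcases eq_or_ne η ⊤ with rfl | hηtop
    · obtain ⟨δ, hδ, -⟩ := h45 T ε hε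
      exact ⟨δ, hδ, Eventually.of_forall fun n ↦ le_top⟩
    have hηr : 0 < η.toReal := ENNReal.toReal_pos hη.ne' hηtop
    set ε' : ℝ := min ε η.toReal with hε'
    have hε'0 : 0 < ε' := lt_min hε hηr
    obtain ⟨δ, hδ, hev⟩ := h45 T ε' hε'0
    refine ⟨δ, hδ, ?_⟩
    filter_upwards [hev] with n hn
    refine le_trans (measure_mono ?_) (hn.le.trans ?_)
    · rintro ω ⟨s, s', hs, hs', hss', hd⟩
      exact ⟨s, s', hs, hs', hss', (min_le_left _ _).trans hd⟩
    · calc ENNReal.ofReal ε' ≤ ENNReal.ofReal η.toReal := ENNReal.ofReal_le_ofReal (min_le_right _ _)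
        _ = η := ENNReal.ofReal_toReal hηtop

/-- **Driving convergence from Thm. 4.4-shaped couplings.** If for every horizon `T` and
`ε₂, ε₃ > 0`, eventually in `n`, there is a coupling `ρ` of the law of `Ξₙ` with the law of the
SLE_κ driving path `√κ B` (equivalently of `B(κt)`, `map_timeScaledPath_eq_map_drivingPath`) with
`ρ[∃ t ≤ T, ε₂ ≤ |W(t) - W'(t)|] < ε₃` (the shape of [LSW04] Thm. 4.4 along `Rₙ → ∞`), then
`Ξₙ → √κ B` in distribution on `C([0, ∞), ℝ)` (`Process.tendstoInDistribution_of_coupling`).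
[LSW04] p. 981 ("Theorem 4.4 implies that the law of `W` converges weakly to the law of
`B(8t)`"). [cite: LawlerSchrammWerner2004, proof of Thm. 4.7] -/
theorem tendstoInDistribution_of_thm44_shape [Fact Process.isProjectiveLimit_preWienerMeasure]
    (hΞ : ∀ n, AEMeasurable (Ξ n) (P n))
    (h44 : ∀ (T ε₂ ε₃ : ℝ), 0 < ε₂ → 0 < ε₃ → ∀ᶠ n in atTop,
      ∃ ρ : Measure (C(ℝ≥0, ℝ) × C(ℝ≥0, ℝ)), ρ.fst = (P n).map (Ξ n) ∧
        ρ.snd = Process.preWienerMeasure.map (drivingPath κ) ∧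
        ρ {p | ∃ t : ℝ≥0, (t : ℝ) ≤ T ∧ ε₂ ≤ dist (p.1 t) (p.2 t)} < ENNReal.ofReal ε₃) :
    TendstoInDistribution Ξ atTop (drivingPath κ) P Process.preWienerMeasure := by
  refine Process.tendstoInDistribution_of_coupling hΞ (measurable_drivingPath κ).aemeasurable
    fun T ε hε η hη ↦ ?_
  rcases eq_or_ne η ⊤ with rfl | hηtop
  · filter_upwards [h44 T ε 1 hε one_pos] with n ⟨ρ, h1, h2, _⟩
    exact ⟨ρ, h1, h2, le_top⟩
  · filter_upwards [h44 T ε η.toReal hε (ENNReal.toReal_pos hη.ne' hηtop)] with n ⟨ρ, h1, h2, h3⟩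
    exact ⟨ρ, h1, h2, h3.le.trans (ENNReal.ofReal_toReal hηtop).le⟩

/-- **[LSW04] Thm. 4.7 from its two probabilistic inputs, abstract form (any `κ ≠ 0`).** Let
`Γₙ` be random continuous curves from `0` and `Ξₙ` random continuous driving functions on
probability spaces, a.e.-measurable, with a.s. the chordal Loewner chain of `Ξₙ` generated by
`Γₙ`. Assume the Prop. 4.5-shaped modulus bound for the `Γₙ` (`isTightMeasureSet_of_prop45_shape`)
and Thm. 4.4-shaped couplings of the `Ξₙ` with the law of `√κ B` (= law of `B(κt)`)
(`tendstoInDistribution_of_thm44_shape`). Then SLE_κ is almost surely generated by a curve. The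
canonical-space facts enter in proved form, so the conclusion is the bare `HasSLETrace κ`.
[cite: LawlerSchrammWerner2004, Thm. 4.7] -/
theorem hasSLETrace_of_inputs (hΓ : ∀ n, AEMeasurable (Γ n) (P n))
    (hΞ : ∀ n, AEMeasurable (Ξ n) (P n))
    (hgen : ∀ n, ∀ᵐ ω ∂P n, Loewner.IsGeneratedByCurve (Ξ n ω) (Γ n ω))
    (h0 : ∀ n ω, Γ n ω 0 = 0)
    (h45 : ∀ (t ε : ℝ), 0 < ε → ∃ δ : ℝ, 0 < δ ∧ ∀ᶠ n in atTop,
      P n {ω | ∃ s s' : ℝ≥0, (s : ℝ) ≤ t ∧ (s' : ℝ) ≤ t ∧ dist s s' ≤ δ ∧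
        ε ≤ dist (Γ n ω s) (Γ n ω s')} < ENNReal.ofReal ε)
    (h44 : ∀ (T ε₂ ε₃ : ℝ), 0 < ε₂ → 0 < ε₃ → ∀ᶠ n in atTop,
      ∃ ρ : Measure (C(ℝ≥0, ℝ) × C(ℝ≥0, ℝ)), ρ.fst = (P n).map (Ξ n) ∧
        ρ.snd = Process.preWienerMeasure.map (drivingPath κ) ∧
        ρ {p | ∃ t : ℝ≥0, (t : ℝ) ≤ T ∧ ε₂ ≤ dist (p.1 t) (p.2 t)} < ENNReal.ofReal ε₃) :
    HasSLETrace κ := by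
  haveI : Fact Process.isProjectiveLimit_preWienerMeasure := ⟨isProjectiveLimit_preWienerMeasure_holds'⟩
  exact hasSLETrace_of_tendstoInDistribution hΓ hgen (isTightMeasureSet_of_prop45_shape hΓ h0 h45)
    (tendstoInDistribution_of_thm44_shape hΞ h44)

end Inputs

/-- **`hasSLETrace_eight` from its two probabilistic inputs** ([LSW04] Prop. 4.5 and Thm. 4.4 for
the UST Peano curves, along any sequence `Rₙ → ∞`, in the printed shapes): the `κ = 8` case of
`hasSLETrace_of_inputs`. This is the proof of [LSW04] Thm. 4.7 (p. 981) with every deterministic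
and measure-theoretic step discharged; its hypotheses are what the UST theory of [LSW04] §4 must
supply. [cite: LawlerSchrammWerner2004, Thm. 4.7] -/
theorem hasSLETrace_eight_of_inputs {Ω : ℕ → Type*} [∀ n, MeasurableSpace (Ω n)]
    {P : ∀ n, Measure (Ω n)} [∀ n, IsProbabilityMeasure (P n)]
    {Γ : ∀ n, Ω n → C(ℝ≥0, ℂ)} {Ξ : ∀ n, Ω n → C(ℝ≥0, ℝ)}
    (hΓ : ∀ n, AEMeasurable (Γ n) (P n)) (hΞ : ∀ n, AEMeasurable (Ξ n) (P n))
    (hgen : ∀ n, ∀ᵐ ω ∂P n, Loewner.IsGeneratedByCurve (Ξ n ω) (Γ n ω))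
    (h0 : ∀ n ω, Γ n ω 0 = 0)
    (h45 : ∀ (t ε : ℝ), 0 < ε → ∃ δ : ℝ, 0 < δ ∧ ∀ᶠ n in atTop,
      P n {ω | ∃ s s' : ℝ≥0, (s : ℝ) ≤ t ∧ (s' : ℝ) ≤ t ∧ dist s s' ≤ δ ∧
        ε ≤ dist (Γ n ω s) (Γ n ω s')} < ENNReal.ofReal ε)
    (h44 : ∀ (T ε₂ ε₃ : ℝ), 0 < ε₂ → 0 < ε₃ → ∀ᶠ n in atTop,
      ∃ ρ : Measure (C(ℝ≥0, ℝ) × C(ℝ≥0, ℝ)), ρ.fst = (P n).map (Ξ n) ∧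
        ρ.snd = Process.preWienerMeasure.map (drivingPath 8) ∧
        ρ {p | ∃ t : ℝ≥0, (t : ℝ) ≤ T ∧ ε₂ ≤ dist (p.1 t) (p.2 t)} < ENNReal.ofReal ε₃) :
    hasSLETrace_eight :=
  hasSLETrace_of_inputs hΓ hΞ hgen h0 h45 h44

end Literature.Probability.RandomPlanarGeometry
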